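import Literature.MathematicalPhysics.QuantumLattice.HubbardTTPrimeOpenBoxPartitionFnCouplingTransport
import Literature.MathematicalPhysics.QuantumLattice.HubbardTTPrimeDoccTransportThermal
import HarnessLib

/-!
# Hot free-energy bounds move DOWN in `U` at a kinematic price; ONE anchor's free-energy-route data
# words a whole `U`-interval (torus-limit thermal convention, producer II / III)

Family `hubbard` (topic `MathematicalPhysics/QuantumLattice`); second part of
`HubbardTTPrimeOpenBoxPartitionFnCouplingTransport` (`U`-direction, `T > 0` leg, FREE-ENERGY ROUTE of stage S2
of the Hubbard material-oracle programme). There the INPUTS of the free-energy-route producers were moved in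
the directions that cost nothing — open-box partition-function FLOORS down in `U`, torus hot free-energy CAPS up
in `U` — and the floors were moved up in `U` by the Peierls–Bogoliubov tangent. The one remaining move, a hot
CAP `log Re Z_{β_h}(H_L(t,s,U_A)|_sector) ≤ u_h L² + C` read at a SMALLER coupling `U ≤ U_A`, is done here with the
upper Peierls–Bogoliubov tangent at the TARGET (`HubbardTTPrimeDoccTransportThermal.log_partitionFn_sector_sub_mem_Icc_U`,
mixture form) and the kinematic ceiling of the thermal double occupancy of the canonical sector,
`Σ_i p_i Re⟨ψ_i, D ψ_i⟩ ≤ halfRectN n L ≤ n L²/2`: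

* §1 `re_dotProduct_sum_docc_mulVec_le_of_support` — the quadratic form of the double occupancy on a vector
  supported on configurations with at most `k` doubly occupied sites is at most `k‖ψ‖²` (any finite site set;
  an instance-free statement, so it specialises to the torus);
  `sectorGibbs_doccMean_le_halfRectN` / `…_le_half_density_mul_sq` — the thermal docc mean of the canonical
  sector Gibbs state of `H_L(t,s,U)` is at most `halfRectN n L ≤ (n/2)·L²`.
* §2 `log_partitionFn_sectorHamiltonianTT'_le_add_of_le_U` — for `U ≤ U_A`, `β ≥ 0`:
  `log Re Z_β(H_L(t,s,U)|_s) ≤ log Re Z_β(H_L(t,s,U_A)|_s) + β(U_A − U)·(n/2)·L²`; two-sided form with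
  `max(U_A − U, 0)` valid at EVERY `U` (`…_le_add_max`); eventual forms: a hot bound `u_h L² + C` certified at
  `U_A` gives `(u_h + β_h·max(U_A−U,0)·n/2) L² + C` at every `U` (`eventually_log_partitionFn_sectorHamiltonianTT'_le_of_anchorU`),
  and a grand-canonical pressure bound `P` at `(β_h, μ, U_A)` gives
  `(P − β_h μ n + β_h·max(U_A−U,0)·n/2) L² + 2|β_h μ|` (`…_le_of_grandCanonical_anchorU`).
* §3 PRODUCER II FROM ONE ANCHOR (`…le_hot_sub_chord_div_of_anchorU_allTori`): the two open-box floors `zp, zq`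
  and the hot sector bound `u_h`, ALL certified at the anchor coupling `U_A`, word every target `U`:
  `e_{Φ(t,s,U)}(ω) ≤ (u_h + β_h·(U_A−U)⁺·n/2 − chord(n)/a² + β·(U−U_A)⁺·n/2)/(β − β_h)` for every torus-limit
  thermal state at `(t,s,U)`, `n ∈ [2p/a², 2(p+1)/a²)` (below the anchor the box floors are free and the hot cap
  pays `β_h·n/2` per unit of `U`; above the anchor the hot cap is free and the box floors pay `β·n/2`);
  PRODUCER III from one anchor (`…le_grandCanonical_sub_chord_div_of_anchorU_allTori`).

Everything is PROVED; no definition, no named fact, no number. HONEST SCOPE: kinematic constants (`n/2` per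
unit of `U`); certified docc data at the anchor (open box) or a thermal docc ceiling word at the target (torus,
`HubbardTTPrimeDoccTransportThermal` §3) sharpen them but are not wired in here. WHAT THIS IS NOT: a number, a
certificate or a phase verdict — transport lemmas and the producers fed with transported inputs.

## Mathlib / tree search

REUSED: `log_partitionFn_sector_sub_mem_Icc_U` (mixture-form PB bracket along `U`), `sectorGibbsWeightTT'_nonneg`,
`sum_sectorGibbsWeightTT'`, `isInSector_sectorGibbsVectorTT'`, `star_sectorGibbsVectorTT'_dotProduct_self`
(`TorusSectorGibbsMixture`), `InfVolFermionState.hubbardTorusTT'_zero_zero_one` (`HubbardTTPrimeMeanEnergySupergradient`),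
`sum_numberOp_mul_numberOp_eq_diagonal`, `doublyOccupied` (`HubbardAtomicLimit`),
`FreeKinetic.re_rayleigh_interaction_nonneg` (`HubbardFreeKineticLowerBound`), `rectN_le`,
`eventually_log_partitionFn_sectorHamiltonianTT'_le_of_grandCanonical` (`TorusSectorGibbsFillingBoxFreeEnergy`),
`log_partitionFn_sectorHamiltonianTT'_anti_U`, `openBox_partitionFn_floor_transport_U_kinematic`,
`card_doublyOccupied_le_min` (`HubbardTTPrimeOpenBoxPartitionFnCouplingTransport`), the producers
`…le_hot_sub_chord_div_of_fillingBox_allTori` (`TorusSectorGibbsFillingBoxAllTori`). DESIGN NOTE: a generic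
`gibbsState`/`diagonal` docc bound instantiated at `Λ = FermionTorus 2 L` does not elaborate (the `DecidableEq`
instance paths `LinearOrder.toDecidableEq` and `instDecidableEqLex` differ); the mixture form avoids every
`DecidableEq`-carrying constant at the torus type.

## References

* E. H. Lieb, Commun. Math. Phys. 31 (1973) 327–340, §V (5.2)–(5.4) (Bogoliubov's inequality).
  [cite: Lieb1973, §V (5.2)–(5.4)]
* D. Ruelle, *Statistical Mechanics: Rigorous Results* (1969), §2.5, §3.3 (3.11)–(3.18), §3.4.
  [cite: Ruelle1969, §2.5]
* R. B. Israel, *Convexity in the Theory of Lattice Gases* (1979), Theorem I.3.4, Lemma II.3.1.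
  [cite: Israel1979, Thm. I.3.4]
* T. Koma, H. Tasaki, J. Stat. Phys. 76 (1994) 745, §1. [cite: KomaTasaki1994, §1]
* H. Tasaki, *Physics and Mathematics of Quantum Many-Body Systems* (2020), §9.3. [cite: Tasaki2020, §9.3]
-/

noncomputable section

namespace Literature.MathematicalPhysics.QuantumLattice

open Matrix Finset HubbardWave0 ThermodynamicLimit LiebThm1 Literature.Probability.LatticeModels
open _root_.Filter
open scoped _root_.Topology ComplexOrder BigOperators

/-! ### §1 The quadratic form of the double occupancy; the thermal docc mean of the canonical sector -/

section QuadraticForm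

variable {Λ : Type*} [LinearOrder Λ] [Fintype Λ]

/-- **The double occupancy as a quadratic form**: for a vector `ψ` supported on configurations with at most `k`
doubly occupied sites, `Re⟨ψ, (Σ_x n_{x↑}n_{x↓}) ψ⟩ ≤ k · Re⟨ψ, ψ⟩` (the interaction is diagonal in the
occupation basis with eigenvalue the number of doubly occupied sites). [cite: Tasaki2020, §9.3] -/
theorem re_dotProduct_sum_docc_mulVec_le_of_support {k : ℕ} {ψ : Fock (Orb Λ)}
    (hψ : ∀ s, ψ s ≠ 0 → (doublyOccupied s).card ≤ k) :
    (star ψ ⬝ᵥ ((∑ x : Λ, numberOp x 0 * numberOp x 1) *ᵥ ψ)).re ≤ (k : ℝ) * (star ψ ⬝ᵥ ψ).re := by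
  rw [sum_numberOp_mul_numberOp_eq_diagonal]
  simp only [dotProduct, mulVec_diagonal, Pi.star_apply, Complex.re_sum]
  rw [Finset.mul_sum]
  refine Finset.sum_le_sum fun s _ => ?_
  have hz : star (ψ s) * ψ s = (Complex.normSq (ψ s) : ℂ) := by
    rw [Complex.star_def, Complex.normSq_eq_conj_mul_self]
  have e2 : (star (ψ s) * ψ s).re = Complex.normSq (ψ s) := by rw [hz, Complex.ofReal_re]
  have e1 : (star (ψ s) * ((((doublyOccupied s).card : ℕ) : ℂ) * ψ s)).re =
      ((doublyOccupied s).card : ℝ) * Complex.normSq (ψ s) := by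
    rw [mul_left_comm, hz, ← Complex.ofReal_natCast, ← Complex.ofReal_mul, Complex.ofReal_re]
  rw [e1, e2]
  by_cases hs : ψ s = 0
  · simp [hs]
  · exact mul_le_mul_of_nonneg_right (Nat.cast_le.mpr (hψ s hs)) (Complex.normSq_nonneg _)

end QuadraticForm

section Torus

variable {n : ℝ}

/-- `halfRectN n L ≤ n L²/2` (`n ≥ 0`; the sector's up-spin number is the floor of `nL²/2`).
[cite: LiebPRL1989, proof of Theorem 1] -/
theorem halfRectN_le_half_density_mul_sq (hn0 : 0 ≤ n) (L : ℕ) :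
    (halfRectN n L : ℝ) ≤ n / 2 * (L : ℝ) ^ 2 := by
  unfold halfRectN
  have h := Nat.floor_le (a := n * (L : ℝ) ^ 2 / 2) (by positivity)
  linarith

/-- **The thermal docc mean of the canonical sector Gibbs state is at most `halfRectN n L`** (every
real `β`; every component of the mixture is a unit vector with `halfRectN n L` up and down electrons, hence at
most that many doubly occupied sites). [cite: Tasaki2020, §9.3] [cite: Israel1979, Lemma II.3.1] -/
theorem sectorGibbs_doccMean_le_halfRectN (hn0 : 0 ≤ n) (hn2 : n ≤ 2) (L : ℕ) (β t s U : ℝ) :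
    ∑ i, sectorGibbsWeightTT' β t s U n L i *
        (expect (hubbardTorusTT' L 0 0 1) (sectorGibbsVectorTT' t s U n L i)).re ≤
      (halfRectN n L : ℝ) := by
  have hterm : ∀ i, (expect (hubbardTorusTT' L 0 0 1) (sectorGibbsVectorTT' t s U n L i)).re ≤
      (halfRectN n L : ℝ) := by
    intro i
    have hsupp : ∀ c, sectorGibbsVectorTT' t s U n L i c ≠ 0 →
        (doublyOccupied c).card ≤ halfRectN n L := by
      intro c hc
      have hin := isInSector_sectorGibbsVectorTT' t s U n L i
      have hcfg : (upPart c).card = halfRectN n L ∧ (downPart c).card = halfRectN n L := by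
        by_contra hnot
        exact hc (hin c hnot)
      exact (card_doublyOccupied_le_min (p := halfRectN n L) (q := halfRectN n L) hcfg).trans
        (min_le_left _ _)
    have h := re_dotProduct_sum_docc_mulVec_le_of_support hsupp
    rw [← InfVolFermionState.hubbardTorusTT'_zero_zero_one L, star_sectorGibbsVectorTT'_dotProduct_self,
      Complex.one_re, mul_one] at h
    exact h
  calc ∑ i, sectorGibbsWeightTT' β t s U n L i *
        (expect (hubbardTorusTT' L 0 0 1) (sectorGibbsVectorTT' t s U n L i)).re
      ≤ ∑ i, sectorGibbsWeightTT' β t s U n L i * (halfRectN n L : ℝ) :=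
        Finset.sum_le_sum fun i _ =>
          mul_le_mul_of_nonneg_left (hterm i) (sectorGibbsWeightTT'_nonneg β t s U n L i)
    _ = (halfRectN n L : ℝ) := by
        rw [← Finset.sum_mul, sum_sectorGibbsWeightTT' β t s U hn0 hn2 L, one_mul]

/-- **Kinematic ceiling of the thermal docc mean per site**: `Σ_i p_i Re⟨ψ_i, D ψ_i⟩ ≤ (n/2)·L²`.
[cite: Tasaki2020, §9.3] [cite: Israel1979, Lemma II.3.1] -/
theorem sectorGibbs_doccMean_le_half_density_mul_sq (hn0 : 0 ≤ n) (hn2 : n ≤ 2) (L : ℕ)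
    (β t s U : ℝ) :
    ∑ i, sectorGibbsWeightTT' β t s U n L i *
        (expect (hubbardTorusTT' L 0 0 1) (sectorGibbsVectorTT' t s U n L i)).re ≤
      n / 2 * (L : ℝ) ^ 2 :=
  (sectorGibbs_doccMean_le_halfRectN hn0 hn2 L β t s U).trans (halfRectN_le_half_density_mul_sq hn0 L)

/-- The thermal docc mean of the canonical sector Gibbs state is nonnegative. [cite: Tasaki2020, §9.3] -/
theorem sectorGibbs_doccMean_nonneg (L : ℕ) (β t s U n : ℝ) :
    0 ≤ ∑ i, sectorGibbsWeightTT' β t s U n L i *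
        (expect (hubbardTorusTT' L 0 0 1) (sectorGibbsVectorTT' t s U n L i)).re := by
  refine Finset.sum_nonneg fun i _ => mul_nonneg (sectorGibbsWeightTT'_nonneg β t s U n L i) ?_
  have h := FreeKinetic.re_rayleigh_interaction_nonneg (sectorGibbsVectorTT' t s U n L i)
  rw [← InfVolFermionState.hubbardTorusTT'_zero_zero_one L] at h
  exact h

/-! ### §2 Hot caps move DOWN in `U` at the kinematic price `β(U_A − U)·(n/2)·L²` -/

/-- **A canonical-sector `log`-partition-function CAP moves DOWN in `U`** (`0 ≤ n ≤ 2`, `β ≥ 0`, `L ≥ 1`):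
for `U ≤ U_A`, `log Re Z_β(H_L(t,s,U)|_s) ≤ log Re Z_β(H_L(t,s,U_A)|_s) + β(U_A − U)·(n/2)·L²` (upper
Peierls–Bogoliubov tangent at the target, thermal docc of the target at most `n/2` per site).
[cite: Lieb1973, §V (5.2)–(5.4)] [cite: KomaTasaki1994, §1] -/
theorem log_partitionFn_sectorHamiltonianTT'_le_add_of_le_U (hn0 : 0 ≤ n) (hn2 : n ≤ 2) (L : ℕ)
    [NeZero L] (t s : ℝ) {β : ℝ} (hβ : 0 ≤ β) {U U₀ : ℝ} (hU : U ≤ U₀) :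
    Real.log (partitionFn β (sectorHamiltonianTT' t s U n L)).re ≤
      Real.log (partitionFn β (sectorHamiltonianTT' t s U₀ n L)).re + β * (U₀ - U) * (n / 2 * (L : ℝ) ^ 2) := by
  have hb := (log_partitionFn_sector_sub_mem_Icc_U hn0 hn2 L t s β U U₀).2
  have hd := sectorGibbs_doccMean_le_half_density_mul_sq hn0 hn2 L β t s U
  have hc : 0 ≤ β * (U₀ - U) := mul_nonneg hβ (sub_nonneg.2 hU)
  have hm := mul_le_mul_of_nonneg_left hd hc
  nlinarith [hb, hm]

/-- **Two-sided form, valid at EVERY `U`** (`β ≥ 0`): `log Re Z_β(H_L(t,s,U)|_s) ≤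
log Re Z_β(H_L(t,s,U_A)|_s) + β·max(U_A − U, 0)·(n/2)·L²` (above the anchor the cap moves for free).
[cite: Lieb1973, §V (5.2)–(5.4)] [cite: Israel1979, Thm. I.3.4] -/
theorem log_partitionFn_sectorHamiltonianTT'_le_add_max (hn0 : 0 ≤ n) (hn2 : n ≤ 2) (L : ℕ) [NeZero L]
    (t s : ℝ) {β : ℝ} (hβ : 0 ≤ β) (U U₀ : ℝ) :
    Real.log (partitionFn β (sectorHamiltonianTT' t s U n L)).re ≤
      Real.log (partitionFn β (sectorHamiltonianTT' t s U₀ n L)).re +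
        β * max (U₀ - U) 0 * (n / 2 * (L : ℝ) ^ 2) := by
  rcases le_total U U₀ with hU | hU
  · rw [max_eq_left (sub_nonneg.2 hU)]
    exact log_partitionFn_sectorHamiltonianTT'_le_add_of_le_U hn0 hn2 L t s hβ hU
  · rw [max_eq_right (sub_nonpos.2 hU), mul_zero, zero_mul, add_zero]
    exact log_partitionFn_sectorHamiltonianTT'_anti_U hn0 hn2 L t s hβ hU

/-- **An eventual hot canonical bound certified at the anchor `U_A` holds at every `U` with the kinematic
surcharge**: `log Re Z_{β_h}(H_{L_j}(t,s,U_A)|_s) ≤ u_h L_j² + C` eventually along `Ls → ∞` gives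
`log Re Z_{β_h}(H_{L_j}(t,s,U)|_s) ≤ (u_h + β_h·max(U_A − U, 0)·n/2) L_j² + C` eventually (`β_h ≥ 0`).
[cite: Israel1979, Thm. I.3.4] [cite: Lieb1973, §V (5.2)–(5.4)] -/
theorem eventually_log_partitionFn_sectorHamiltonianTT'_le_of_anchorU (hn0 : 0 ≤ n) (hn2 : n ≤ 2)
    (t s : ℝ) {βh : ℝ} (hβh : 0 ≤ βh) (U U₀ : ℝ) {Ls : ℕ → ℕ} (hLs : Tendsto Ls atTop atTop) {uh C : ℝ}
    (huh : ∀ᶠ j in atTop, Real.log (partitionFn βh (sectorHamiltonianTT' t s U₀ n (Ls j))).re ≤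
      uh * (Ls j : ℝ) ^ 2 + C) :
    ∀ᶠ j in atTop, Real.log (partitionFn βh (sectorHamiltonianTT' t s U n (Ls j))).re ≤
      (uh + βh * max (U₀ - U) 0 * (n / 2)) * (Ls j : ℝ) ^ 2 + C := by
  filter_upwards [huh, hLs.eventually_ge_atTop 1] with j hj hj1
  haveI : NeZero (Ls j) := ⟨by omega⟩
  have h := log_partitionFn_sectorHamiltonianTT'_le_add_max hn0 hn2 (Ls j) t s hβh U U₀
  nlinarith [h, hj]

/-- **One grand-canonical pressure bound at the anchor is a hot canonical bound at every `U`**: an eventual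
bound `log Re Z_{β_h}(H_{L_j}(t,s,U_A) − μN) ≤ P·L_j²` gives, for `0 ≤ n ≤ 2` and every `U`, eventually
`log Re Z_{β_h}(H_{L_j}(t,s,U)|_s) ≤ (P − β_h μ n + β_h·max(U_A − U, 0)·n/2)·L_j² + 2|β_h μ|` (`β_h ≥ 0`).
[cite: Ruelle1969, §3.4] [cite: Israel1979, Thm. I.3.4] -/
theorem eventually_log_partitionFn_sectorHamiltonianTT'_le_of_grandCanonical_anchorU (hn0 : 0 ≤ n)
    (hn2 : n ≤ 2) (t s : ℝ) {βh : ℝ} (hβh : 0 ≤ βh) (U U₀ μ : ℝ) {Ls : ℕ → ℕ}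
    (hLs : Tendsto Ls atTop atTop) {P : ℝ}
    (hP : ∀ᶠ j in atTop, Real.log (partitionFn βh (hubbardTorusTT' (Ls j) t s U₀ -
      (μ : ℂ) • totalNumber)).re ≤ P * (Ls j : ℝ) ^ 2) :
    ∀ᶠ j in atTop, Real.log (partitionFn βh (sectorHamiltonianTT' t s U n (Ls j))).re ≤
      (P - βh * μ * n + βh * max (U₀ - U) 0 * (n / 2)) * (Ls j : ℝ) ^ 2 + 2 * |βh * μ| :=
  eventually_log_partitionFn_sectorHamiltonianTT'_le_of_anchorU hn0 hn2 t s hβh U U₀ hLs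
    (eventually_log_partitionFn_sectorHamiltonianTT'_le_of_grandCanonical t s U₀ hn0 hn2 βh μ hP)

end Torus

/-! ### §3 Producer II / III from ONE anchor coupling -/

namespace InfVolFermionState

variable {ω : InfVolFermionState 2} {Ls : ℕ → ℕ} {β t s U n : ℝ}

/-- **PRODUCER II FROM ONE ANCHOR.** Filling interval `n ∈ [2p/a², 2(p+1)/a²)`, `0 < β_h < β`, a target coupling
`U` and an anchor coupling `U_A`, with ALL inputs certified at the anchor: the open-box floors
`0 < zp ≤ Re Z_β(H^open_{a×a}(t,s,U_A); p,p)`, `0 < zq ≤ Re Z_β(H^open_{a×a}(t,s,U_A); p+1,p+1)` and the hot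
canonical bound `log Re Z_{β_h}(H_{L_j}(t,s,U_A)|_s) ≤ u_h L_j² + C` eventually. Then every torus-limit thermal
state at `(t, s, U)` satisfies
`e_{Φ(t,s,U)}(ω) ≤ (u_h + β_h·max(U_A−U,0)·n/2 − chord(n)/a² + β·max(U−U_A,0)·n/2)/(β − β_h)`,
`chord(n) = log zp + (n a²/2 − p)(log zq − log zp)`: below the anchor the box floors are free and the hot cap pays
`β_h·n/2` per unit of `U`, above the anchor the hot cap is free and the box floors pay `β·n/2`.
[cite: Ruelle1969, §2.5–2.6, §3.3 (3.11)–(3.18)] [cite: Lieb1973, §V (5.2)–(5.4)] [cite: Israel1979, Thm. I.3.4] -/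
theorem IsTorusLimitOfMixture.meanEnergy_hubbardTTPrime_le_hot_sub_chord_div_of_anchorU_allTori
    {a p : ℕ} (ha : 1 ≤ a) (hp : p + 1 ≤ a * a)
    (hlo : 2 * (p : ℝ) / (a : ℝ) ^ 2 ≤ n) (hhi : n < 2 * ((p : ℝ) + 1) / (a : ℝ) ^ 2)
    (h : ω.IsTorusLimitOfMixture (sectorGibbsCount n) (fun L => sectorGibbsWeightTT' β t s U n L)
      (fun L => sectorGibbsVectorTT' t s U n L) Ls)
    (hLs : Tendsto Ls atTop atTop) {βh : ℝ} (hβh : 0 < βh) (hlt : βh < β) (U₀ : ℝ)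
    {zp zq : ℝ} (hzp0 : 0 < zp)
    (hzp : zp ≤ (partitionFn β (spinSectorHamiltonian p p (hubbardOpenBoxTT' a a t s U₀))).re)
    (hzq0 : 0 < zq)
    (hzq : zq ≤ (partitionFn β (spinSectorHamiltonian (p + 1) (p + 1) (hubbardOpenBoxTT' a a t s U₀))).re)
    {uh C : ℝ}
    (huh : ∀ᶠ j in atTop, Real.log (partitionFn βh (sectorHamiltonianTT' t s U₀ n (Ls j))).re ≤
      uh * (Ls j : ℝ) ^ 2 + C) :
    ω.meanEnergy (hubbardTTPrimeFermionInteraction t s U) 1 ≤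
      (uh + βh * max (U₀ - U) 0 * (n / 2) -
          (Real.log zp + (n * (a : ℝ) ^ 2 / 2 - p) * (Real.log zq - Real.log zp)) / (a : ℝ) ^ 2 +
          β * max (U - U₀) 0 * (n / 2)) / (β - βh) := by
  have hβ : 0 ≤ β := hβh.le.trans hlt.le
  obtain ⟨hn0, hn2⟩ := filling_bounds_of_box_interval ha hp hlo hhi.le
  have ha0 : (0 : ℝ) < (a : ℝ) := by exact_mod_cast ha
  have ha2 : (a : ℝ) ^ 2 ≠ 0 := by positivity
  -- transported inputs
  have hzp' := openBox_partitionFn_floor_transport_U_kinematic a a p p t s hβ U U₀ hzp0 hzp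
  have hzq' := openBox_partitionFn_floor_transport_U_kinematic a a (p + 1) (p + 1) t s hβ U U₀ hzq0 hzq
  rw [min_self] at hzp' hzq'
  have hzp0' := mul_pos hzp0 (Real.exp_pos (-(β * (max (U - U₀) 0 * ((p : ℕ) : ℝ)))))
  have hzq0' := mul_pos hzq0 (Real.exp_pos (-(β * (max (U - U₀) 0 * ((p + 1 : ℕ) : ℝ)))))
  have huh' := eventually_log_partitionFn_sectorHamiltonianTT'_le_of_anchorU hn0 hn2 t s hβh.le U U₀ hLs huh
  have hmain := h.meanEnergy_hubbardTTPrime_le_hot_sub_chord_div_of_fillingBox_allTori ha hp hlo hhi hLs hβh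
    hlt hzp0' hzp' hzq0' hzq' huh'
  rw [Real.log_mul hzp0.ne' (Real.exp_pos _).ne', Real.log_exp,
    Real.log_mul hzq0.ne' (Real.exp_pos _).ne', Real.log_exp] at hmain
  refine hmain.trans_eq ?_
  congr 1
  push_cast
  field_simp
  ring

/-- **PRODUCER III FROM ONE ANCHOR** (grand-canonical hot input): as in producer II, with the hot input a
grand-canonical pressure bound `log Re Z_{β_h}(H_{L_j}(t,s,U_A) − μN) ≤ P·L_j²` at the anchor:
`e_{Φ(t,s,U)}(ω) ≤ (P − β_h μ n + β_h·max(U_A−U,0)·n/2 − chord(n)/a² + β·max(U−U_A,0)·n/2)/(β − β_h)`.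
[cite: Ruelle1969, §2.5–2.6, §3.3 (3.11)–(3.18), §3.4] [cite: Israel1979, Thm. I.3.4] -/
theorem IsTorusLimitOfMixture.meanEnergy_hubbardTTPrime_le_grandCanonical_sub_chord_div_of_anchorU_allTori
    {a p : ℕ} (ha : 1 ≤ a) (hp : p + 1 ≤ a * a)
    (hlo : 2 * (p : ℝ) / (a : ℝ) ^ 2 ≤ n) (hhi : n < 2 * ((p : ℝ) + 1) / (a : ℝ) ^ 2)
    (h : ω.IsTorusLimitOfMixture (sectorGibbsCount n) (fun L => sectorGibbsWeightTT' β t s U n L)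
      (fun L => sectorGibbsVectorTT' t s U n L) Ls)
    (hLs : Tendsto Ls atTop atTop) {βh : ℝ} (hβh : 0 < βh) (hlt : βh < β) (U₀ : ℝ)
    {zp zq : ℝ} (hzp0 : 0 < zp)
    (hzp : zp ≤ (partitionFn β (spinSectorHamiltonian p p (hubbardOpenBoxTT' a a t s U₀))).re)
    (hzq0 : 0 < zq)
    (hzq : zq ≤ (partitionFn β (spinSectorHamiltonian (p + 1) (p + 1) (hubbardOpenBoxTT' a a t s U₀))).re)
    (μ : ℝ) {P : ℝ}
    (hP : ∀ᶠ j in atTop, Real.log (partitionFn βh (hubbardTorusTT' (Ls j) t s U₀ -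
      (μ : ℂ) • totalNumber)).re ≤ P * (Ls j : ℝ) ^ 2) :
    ω.meanEnergy (hubbardTTPrimeFermionInteraction t s U) 1 ≤
      (P - βh * μ * n + βh * max (U₀ - U) 0 * (n / 2) -
          (Real.log zp + (n * (a : ℝ) ^ 2 / 2 - p) * (Real.log zq - Real.log zp)) / (a : ℝ) ^ 2 +
          β * max (U - U₀) 0 * (n / 2)) / (β - βh) := by
  obtain ⟨hn0, hn2⟩ := filling_bounds_of_box_interval ha hp hlo hhi.le
  exact h.meanEnergy_hubbardTTPrime_le_hot_sub_chord_div_of_anchorU_allTori ha hp hlo hhi hLs hβh hlt U₀ hzp0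
    hzp hzq0 hzq (eventually_log_partitionFn_sectorHamiltonianTT'_le_of_grandCanonical t s U₀ hn0 hn2 βh μ hP)

end InfVolFermionState

end Literature.MathematicalPhysics.QuantumLattice

/-! ### §4 (appended) WORD-PRICED downward move of a hot cap: a certified thermal docc CEILING word at
`(β_h, U₁)`, `U₁ ≤ U ≤ U_A`, replaces the kinematic `n/2` (compactness makes the word an eventual
finite-volume slope); producer II from one anchor at that price -/

namespace Literature.MathematicalPhysics.QuantumLattice

open Matrix Finset HubbardWave0 ThermodynamicLimit LiebThm1 Literature.Probability.LatticeModels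
open _root_.Filter
open scoped _root_.Topology ComplexOrder BigOperators

namespace InfVolFermionState

section WordPriced

variable {t s n β : ℝ}

/-- **A thermal docc-CEILING word bounds the finite-volume thermal docc means eventually** (the `U`-twin of
`eventually_sectorGibbs_diagHopMean_le_of_forall`): if `D(ω) ≤ A` for every torus limit of the canonical sector
Gibbs states at `(β, t, s, U, n)` (any tori), then along every `Ls → ∞` and for every `ε > 0`, eventually
`Σ_i p_{Ls j,i} Re⟨ψ_i, H_{Ls j}(0,0,1) ψ_i⟩ ≤ (A + ε)·(Ls j)²` (compactness of the thermal torus-limit class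
and `tendsto_meanEnergy_hubbardTTPrime 0 0 1`).
[cite: BratteliRobinsonI1987, Thm. 2.3.15 (weak-⋆ compactness of the state space) and §4.3.1] -/
theorem eventually_sectorGibbs_doccMean_le_of_forall (hn0 : 0 ≤ n) (hn2 : n ≤ 2) {U A : ℝ}
    (hA : ∀ (ω : InfVolFermionState 2) (Ls : ℕ → ℕ), Tendsto Ls atTop atTop →
      ω.IsTorusLimitOfMixture (sectorGibbsCount n) (fun L => sectorGibbsWeightTT' β t s U n L)
        (fun L => sectorGibbsVectorTT' t s U n L) Ls →
      ω.meanEnergy (hubbardTTPrimeFermionInteraction 0 0 1) 1 ≤ A)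
    {Ls : ℕ → ℕ} (hLs : Tendsto Ls atTop atTop) {ε : ℝ} (hε : 0 < ε) :
    ∀ᶠ j in atTop, ∑ i, sectorGibbsWeightTT' β t s U n (Ls j) i *
        (QuantumLattice.expect (hubbardTorusTT' (Ls j) 0 0 1) (sectorGibbsVectorTT' t s U n (Ls j) i)).re ≤
      (A + ε) * (Ls j : ℝ) ^ 2 := by
  by_contra hcon
  rw [Filter.not_eventually] at hcon
  obtain ⟨φ, hφ, hφP⟩ := Filter.extraction_of_frequently_atTop hcon
  have hLφ : Tendsto (Ls ∘ φ) atTop atTop := hLs.comp hφ.tendsto_atTop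
  obtain ⟨φ', hφ', ω, hω⟩ := exists_isTorusLimitOfMixture_sectorGibbs β t s U hn0 hn2 hLφ
  have hLφφ : Tendsto ((Ls ∘ φ) ∘ φ') atTop atTop := hLφ.comp hφ'.tendsto_atTop
  have hlim := hω.tendsto_meanEnergy_hubbardTTPrime 0 0 1 hLφφ
  have hge : A + ε ≤ ω.meanEnergy (hubbardTTPrimeFermionInteraction 0 0 1) 1 := by
    refine ge_of_tendsto hlim ?_
    filter_upwards [hLφφ.eventually_ge_atTop 1] with j hj
    have hj' : 1 ≤ Ls (φ (φ' j)) := hj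
    have hL1 : (0 : ℝ) < (Ls (φ (φ' j)) : ℝ) := by exact_mod_cast hj'
    have hL2 : (0 : ℝ) < (Ls (φ (φ' j)) : ℝ) ^ 2 := by positivity
    have hnot := hφP (φ' j)
    rw [not_le] at hnot
    have hsum : ∑ i, sectorGibbsWeightTT' β t s U n (Ls (φ (φ' j))) i *
        ((QuantumLattice.expect (hubbardTorusTT' (Ls (φ (φ' j))) 0 0 1)
          (sectorGibbsVectorTT' t s U n (Ls (φ (φ' j))) i)).re / (Ls (φ (φ' j)) : ℝ) ^ 2) =
        (∑ i, sectorGibbsWeightTT' β t s U n (Ls (φ (φ' j))) i *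
          (QuantumLattice.expect (hubbardTorusTT' (Ls (φ (φ' j))) 0 0 1)
            (sectorGibbsVectorTT' t s U n (Ls (φ (φ' j))) i)).re) / (Ls (φ (φ' j)) : ℝ) ^ 2 := by
      rw [Finset.sum_div]
      exact Finset.sum_congr rfl fun i _ => by ring
    show A + ε ≤ ∑ i, sectorGibbsWeightTT' β t s U n (Ls (φ (φ' j))) i *
        ((QuantumLattice.expect (hubbardTorusTT' (Ls (φ (φ' j))) 0 0 1)
          (sectorGibbsVectorTT' t s U n (Ls (φ (φ' j))) i)).re / (Ls (φ (φ' j)) : ℝ) ^ 2)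
    rw [hsum, le_div_iff₀ hL2]
    exact hnot.le
  have hω' := hA ω ((Ls ∘ φ) ∘ φ') hLφφ hω
  linarith

/-- **WORD-PRICED downward move of a hot canonical cap** (`β > 0`, `0 ≤ n ≤ 2`): if eventually
`log Re Z_β(H_{L_j}(t,s,U_A)|_s) ≤ u L_j² + C` along `Ls → ∞` and `A₁` is a thermal docc-CEILING word at `(β, U₁)`
with `U₁ ≤ U ≤ U_A`, then for every `ε > 0` eventually
`log Re Z_β(H_{L_j}(t,s,U)|_s) ≤ (u + β(U_A − U)(A₁ + ε)) L_j² + C` (Peierls–Bogoliubov at the TARGET; the ceiling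
word moved from `U₁` to `U` by `HubbardTTPrimeDoccTransportThermal` §3 and made finite-volume by compactness).
[cite: Lieb1973, §V (5.2)–(5.4)] [cite: BratteliRobinsonI1987, Thm. 2.3.15 (weak-⋆ compactness of the state space) and §4.3.1] -/
theorem eventually_log_partitionFn_sectorHamiltonianTT'_le_of_doccWord_left_U (hn0 : 0 ≤ n) (hn2 : n ≤ 2)
    (hβ : 0 < β) {U₁ U U₀ : ℝ} (hU₁ : U₁ ≤ U) (hU : U ≤ U₀) {A₁ : ℝ}
    (hA₁ : ∀ (ω : InfVolFermionState 2) (Ls : ℕ → ℕ), Tendsto Ls atTop atTop →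
      ω.IsTorusLimitOfMixture (sectorGibbsCount n) (fun L => sectorGibbsWeightTT' β t s U₁ n L)
        (fun L => sectorGibbsVectorTT' t s U₁ n L) Ls →
      ω.meanEnergy (hubbardTTPrimeFermionInteraction 0 0 1) 1 ≤ A₁)
    {Ls : ℕ → ℕ} (hLs : Tendsto Ls atTop atTop) {u C : ℝ}
    (hu : ∀ᶠ j in atTop, Real.log (partitionFn β (sectorHamiltonianTT' t s U₀ n (Ls j))).re ≤
      u * (Ls j : ℝ) ^ 2 + C)
    {ε : ℝ} (hε : 0 < ε) :
    ∀ᶠ j in atTop, Real.log (partitionFn β (sectorHamiltonianTT' t s U n (Ls j))).re ≤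
      (u + β * (U₀ - U) * (A₁ + ε)) * (Ls j : ℝ) ^ 2 + C := by
  have hAU : ∀ (ω : InfVolFermionState 2) (Ls' : ℕ → ℕ), Tendsto Ls' atTop atTop →
      ω.IsTorusLimitOfMixture (sectorGibbsCount n) (fun L => sectorGibbsWeightTT' β t s U n L)
        (fun L => sectorGibbsVectorTT' t s U n L) Ls' →
      ω.meanEnergy (hubbardTTPrimeFermionInteraction 0 0 1) 1 ≤ A₁ :=
    fun ω Ls' hLs' hω =>
      hω.meanEnergy_onSite_le_of_forall_left_U_of_sectorGibbs hn0 hn2 hβ hU₁ hA₁ hLs'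
  filter_upwards [hu, eventually_sectorGibbs_doccMean_le_of_forall hn0 hn2 hAU hLs hε,
    hLs.eventually_ge_atTop 1] with j hj hm hL
  haveI : NeZero (Ls j) := ⟨by omega⟩
  have hb := (log_partitionFn_sector_sub_mem_Icc_U hn0 hn2 (Ls j) t s β U U₀).2
  have h2 : β * ((U₀ - U) * ∑ i, sectorGibbsWeightTT' β t s U n (Ls j) i *
        (QuantumLattice.expect (hubbardTorusTT' (Ls j) 0 0 1) (sectorGibbsVectorTT' t s U n (Ls j) i)).re) ≤
      β * ((U₀ - U) * ((A₁ + ε) * (Ls j : ℝ) ^ 2)) :=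
    mul_le_mul_of_nonneg_left (mul_le_mul_of_nonneg_left hm (sub_nonneg.2 hU)) hβ.le
  have h3 : (u + β * (U₀ - U) * (A₁ + ε)) * (Ls j : ℝ) ^ 2 + C =
      u * (Ls j : ℝ) ^ 2 + C + β * ((U₀ - U) * ((A₁ + ε) * (Ls j : ℝ) ^ 2)) := by ring
  rw [h3]
  linarith

/-- **PRODUCER II FROM ONE ANCHOR, WORD-PRICED BELOW THE ANCHOR** (`n ∈ [2p/a², 2(p+1)/a²)`, `0 < β_h < β`,
`U₁ ≤ U ≤ U_A`): the open-box floors `zp, zq` and the hot bound `u_h` ALL certified at `U_A`, plus a thermal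
docc-CEILING word `A₁` at `(β_h, U₁)` for the hot sector class, give for every torus-limit thermal state at
`(t, s, U)`: `e_{Φ(t,s,U)}(ω) ≤ (u_h + β_h(U_A − U)·A₁ − chord(n)/a²)/(β − β_h)` — the kinematic `n/2` of
`…_of_anchorU_allTori` replaced by the certified `A₁` (the `ε` of the eventual slope is eliminated in the limit).
[cite: Ruelle1969, §2.5–2.6, §3.3 (3.11)–(3.18)] [cite: Lieb1973, §V (5.2)–(5.4)]
[cite: BratteliRobinsonI1987, Thm. 2.3.15 (weak-⋆ compactness of the state space) and §4.3.1] -/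
theorem IsTorusLimitOfMixture.meanEnergy_hubbardTTPrime_le_hot_sub_chord_div_of_anchorU_doccWord_allTori
    {a p : ℕ} (ha : 1 ≤ a) (hp : p + 1 ≤ a * a)
    (hlo : 2 * (p : ℝ) / (a : ℝ) ^ 2 ≤ n) (hhi : n < 2 * ((p : ℝ) + 1) / (a : ℝ) ^ 2)
    {ω : InfVolFermionState 2} {Ls : ℕ → ℕ} {U : ℝ}
    (h : ω.IsTorusLimitOfMixture (sectorGibbsCount n) (fun L => sectorGibbsWeightTT' β t s U n L)
      (fun L => sectorGibbsVectorTT' t s U n L) Ls)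
    (hLs : Tendsto Ls atTop atTop) {βh : ℝ} (hβh : 0 < βh) (hlt : βh < β) {U₁ U₀ : ℝ} (hU₁ : U₁ ≤ U)
    (hU : U ≤ U₀) {zp zq : ℝ} (hzp0 : 0 < zp)
    (hzp : zp ≤ (partitionFn β (spinSectorHamiltonian p p (hubbardOpenBoxTT' a a t s U₀))).re)
    (hzq0 : 0 < zq)
    (hzq : zq ≤ (partitionFn β (spinSectorHamiltonian (p + 1) (p + 1) (hubbardOpenBoxTT' a a t s U₀))).re)
    {uh C : ℝ}
    (huh : ∀ᶠ j in atTop, Real.log (partitionFn βh (sectorHamiltonianTT' t s U₀ n (Ls j))).re ≤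
      uh * (Ls j : ℝ) ^ 2 + C)
    {A₁ : ℝ}
    (hA₁ : ∀ (ω' : InfVolFermionState 2) (Ls' : ℕ → ℕ), Tendsto Ls' atTop atTop →
      ω'.IsTorusLimitOfMixture (sectorGibbsCount n) (fun L => sectorGibbsWeightTT' βh t s U₁ n L)
        (fun L => sectorGibbsVectorTT' t s U₁ n L) Ls' →
      ω'.meanEnergy (hubbardTTPrimeFermionInteraction 0 0 1) 1 ≤ A₁) :
    ω.meanEnergy (hubbardTTPrimeFermionInteraction t s U) 1 ≤
      (uh + βh * (U₀ - U) * A₁ -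
          (Real.log zp + (n * (a : ℝ) ^ 2 / 2 - p) * (Real.log zq - Real.log zp)) / (a : ℝ) ^ 2) /
        (β - βh) := by
  have hβ : 0 ≤ β := hβh.le.trans hlt.le
  obtain ⟨hn0, hn2⟩ := filling_bounds_of_box_interval ha hp hlo hhi.le
  have hd : 0 < β - βh := sub_pos.2 hlt
  have hzpU := openBox_partitionFn_floor_of_le_U a a p p t s hβ hU hzp
  have hzqU := openBox_partitionFn_floor_of_le_U a a (p + 1) (p + 1) t s hβ hU hzq
  -- for every ε > 0 the hot bound at the ε-priced slope, hence the producer bound; then ε → 0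
  refine le_of_forall_pos_le_add fun δ hδ => ?_
  -- choose ε with βh (U₀ - U) ε / (β - βh) ≤ δ
  obtain ⟨ε, hε, hεδ⟩ : ∃ ε : ℝ, 0 < ε ∧ βh * (U₀ - U) * ε / (β - βh) ≤ δ := by
    by_cases hc : βh * (U₀ - U) = 0
    · exact ⟨1, one_pos, by rw [hc, zero_mul, zero_div]; exact hδ.le⟩
    · have hcpos : 0 < βh * (U₀ - U) :=
        lt_of_le_of_ne (mul_nonneg hβh.le (sub_nonneg.2 hU)) (Ne.symm hc)
      have hUU : U₀ - U ≠ 0 := fun h0 => hc (by rw [h0, mul_zero])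
      refine ⟨δ * (β - βh) / (βh * (U₀ - U)), by positivity, le_of_eq ?_⟩
      field_simp
  have huh' := eventually_log_partitionFn_sectorHamiltonianTT'_le_of_doccWord_left_U hn0 hn2 hβh hU₁ hU hA₁
    hLs huh hε
  have hmain := h.meanEnergy_hubbardTTPrime_le_hot_sub_chord_div_of_fillingBox_allTori ha hp hlo hhi hLs hβh
    hlt hzp0 hzpU hzq0 hzqU huh'
  have hsplit : (uh + βh * (U₀ - U) * (A₁ + ε) -
        (Real.log zp + (n * (a : ℝ) ^ 2 / 2 - p) * (Real.log zq - Real.log zp)) / (a : ℝ) ^ 2) / (β - βh) =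
      (uh + βh * (U₀ - U) * A₁ -
          (Real.log zp + (n * (a : ℝ) ^ 2 / 2 - p) * (Real.log zq - Real.log zp)) / (a : ℝ) ^ 2) / (β - βh) +
        βh * (U₀ - U) * ε / (β - βh) := by
    field_simp
    ring
  rw [hsplit] at hmain
  linarith

end WordPriced

end InfVolFermionState

end Literature.MathematicalPhysics.QuantumLattice

/-! ### §5 (appended) Producer II from one anchor with CERTIFIED anchor box-docc windows pricing the move to
larger `U` (the finite traces a box computation can certify alongside `zp, zq`) -/

namespace Literature.MathematicalPhysics.QuantumLattice

open Matrix Finset HubbardWave0 ThermodynamicLimit LiebThm1 Literature.Probability.LatticeModels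
open _root_.Filter
open scoped _root_.Topology ComplexOrder BigOperators

namespace InfVolFermionState

variable {ω : InfVolFermionState 2} {Ls : ℕ → ℕ} {β t s U n : ℝ}

/-- **PRODUCER II FROM ONE ANCHOR, box side PRICED BY CERTIFIED ANCHOR DOCC WINDOWS** (`n ∈ [2p/a², 2(p+1)/a²)`,
`0 < β_h < β`, any target `U`): the open-box floors `zp, zq` at the anchor coupling `U_A` with certified windows
`[dplo, dphi] ∋ ⟨D|⟩_A^{(p,p)}`, `[dqlo, dqhi] ∋ ⟨D|⟩_A^{(p+1,p+1)}` for the two anchor box Gibbs states' docc means,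
and the hot bound `u_h L² + C` at `U_A`, give for every torus-limit thermal state at `(t, s, U)`:
`e_{Φ(t,s,U)}(ω) ≤ (u_h + β_h·max(U_A−U,0)·n/2 − chord(n)/a² + β·((1−λ)M_p + λM_q)/a²)/(β − β_h)`,
`λ = n a²/2 − p`, `M_p = max((U−U_A)dplo, (U−U_A)dphi)`, `M_q = max((U−U_A)dqlo, (U−U_A)dqhi)` (tangent floors of
`HubbardTTPrimeOpenBoxPartitionFnCouplingTransport` §2 for both boxes; the hot side kinematic as in
`…_of_anchorU_allTori`). [cite: Ruelle1969, §2.5–2.6, §3.3 (3.11)–(3.18)] [cite: Lieb1973, §V (5.2)–(5.4)]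
[cite: Israel1979, Thm. I.3.4] -/
theorem IsTorusLimitOfMixture.meanEnergy_hubbardTTPrime_le_hot_sub_chord_div_of_anchorU_doccWindows_allTori
    {a p : ℕ} (ha : 1 ≤ a) (hp : p + 1 ≤ a * a)
    (hlo : 2 * (p : ℝ) / (a : ℝ) ^ 2 ≤ n) (hhi : n < 2 * ((p : ℝ) + 1) / (a : ℝ) ^ 2)
    (h : ω.IsTorusLimitOfMixture (sectorGibbsCount n) (fun L => sectorGibbsWeightTT' β t s U n L)
      (fun L => sectorGibbsVectorTT' t s U n L) Ls)
    (hLs : Tendsto Ls atTop atTop) {βh : ℝ} (hβh : 0 < βh) (hlt : βh < β) (U₀ : ℝ)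
    {zp zq : ℝ} (hzp0 : 0 < zp)
    (hzp : zp ≤ (partitionFn β (spinSectorHamiltonian p p (hubbardOpenBoxTT' a a t s U₀))).re)
    (hzq0 : 0 < zq)
    (hzq : zq ≤ (partitionFn β (spinSectorHamiltonian (p + 1) (p + 1) (hubbardOpenBoxTT' a a t s U₀))).re)
    {dplo dphi dqlo dqhi : ℝ}
    (hdplo : dplo ≤ (gibbsState β (spinSectorHamiltonian p p (hubbardOpenBoxTT' a a t s U₀))
      (spinSectorHamiltonian p p (hubbardOpenBoxTT' a a 0 0 1))).re)
    (hdphi : (gibbsState β (spinSectorHamiltonian p p (hubbardOpenBoxTT' a a t s U₀))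
      (spinSectorHamiltonian p p (hubbardOpenBoxTT' a a 0 0 1))).re ≤ dphi)
    (hdqlo : dqlo ≤ (gibbsState β (spinSectorHamiltonian (p + 1) (p + 1) (hubbardOpenBoxTT' a a t s U₀))
      (spinSectorHamiltonian (p + 1) (p + 1) (hubbardOpenBoxTT' a a 0 0 1))).re)
    (hdqhi : (gibbsState β (spinSectorHamiltonian (p + 1) (p + 1) (hubbardOpenBoxTT' a a t s U₀))
      (spinSectorHamiltonian (p + 1) (p + 1) (hubbardOpenBoxTT' a a 0 0 1))).re ≤ dqhi)
    {uh C : ℝ}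
    (huh : ∀ᶠ j in atTop, Real.log (partitionFn βh (sectorHamiltonianTT' t s U₀ n (Ls j))).re ≤
      uh * (Ls j : ℝ) ^ 2 + C) :
    ω.meanEnergy (hubbardTTPrimeFermionInteraction t s U) 1 ≤
      (uh + βh * max (U₀ - U) 0 * (n / 2) -
          (Real.log zp + (n * (a : ℝ) ^ 2 / 2 - p) * (Real.log zq - Real.log zp)) / (a : ℝ) ^ 2 +
          β * ((1 - (n * (a : ℝ) ^ 2 / 2 - p)) * max ((U - U₀) * dplo) ((U - U₀) * dphi) +
            (n * (a : ℝ) ^ 2 / 2 - p) * max ((U - U₀) * dqlo) ((U - U₀) * dqhi)) / (a : ℝ) ^ 2) /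
        (β - βh) := by
  have hβ : 0 ≤ β := hβh.le.trans hlt.le
  obtain ⟨hn0, hn2⟩ := filling_bounds_of_box_interval ha hp hlo hhi.le
  have ha0 : (0 : ℝ) < (a : ℝ) := by exact_mod_cast ha
  have ha2 : (a : ℝ) ^ 2 ≠ 0 := by positivity
  have hzp' := openBox_partitionFn_floor_transport_U a a p p t s hβ U U₀ hzp0 hzp hdplo hdphi
  have hzq' := openBox_partitionFn_floor_transport_U a a (p + 1) (p + 1) t s hβ U U₀ hzq0 hzq hdqlo hdqhi
  have hzp0' := mul_pos hzp0 (Real.exp_pos (-(β * max ((U - U₀) * dplo) ((U - U₀) * dphi))))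
  have hzq0' := mul_pos hzq0 (Real.exp_pos (-(β * max ((U - U₀) * dqlo) ((U - U₀) * dqhi))))
  have huh' := eventually_log_partitionFn_sectorHamiltonianTT'_le_of_anchorU hn0 hn2 t s hβh.le U U₀ hLs huh
  have hmain := h.meanEnergy_hubbardTTPrime_le_hot_sub_chord_div_of_fillingBox_allTori ha hp hlo hhi hLs hβh
    hlt hzp0' hzp' hzq0' hzq' huh'
  rw [Real.log_mul hzp0.ne' (Real.exp_pos _).ne', Real.log_exp,
    Real.log_mul hzq0.ne' (Real.exp_pos _).ne', Real.log_exp] at hmain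
  refine hmain.trans_eq ?_
  congr 1
  field_simp
  ring

end InfVolFermionState

end Literature.MathematicalPhysics.QuantumLattice
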